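import Literature.MeasureTheory.Integral.BumpApproximateIdentity
import HarnessLib

/-!
# The fundamental lemma of the calculus of variations on a locally compact space (continuous, complex form)

Topic `MeasureTheory/Integral`; namespace `Literature.MeasureTheory.Integral.FundamentalLemma`.

On a locally compact Hausdorff space `X` with a Borel measure `μ` finite on compact sets and charging every
nonempty open set (a Haar measure does: `IsHaarMeasure.toIsOpenPosMeasure`), the inference
"`∫ f · conj P dμ = 0` for all test functions `f` ⟹ the continuous function `P` vanishes identically":

* `eq_zero_of_forall_integral_mul_conj_eq_zero` — test functions `C_c(X, ℂ)`: test against `f := φ · P` with `φ`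
  an Urysohn bump at `x₀` (`BumpApprox.exists_bump_subset` of `BumpApproximateIdentity.lean`); then
  `∫ φ‖P‖² = 0` with a continuous nonnegative compactly supported integrand forces `φ(x₀)‖P x₀‖² = 0`
  (`Continuous.integral_pos_of_hasCompactSupport_nonneg_nonzero`);
* `eq_zero_of_forall_bump_integral_mul_conj_eq_zero` — the same for test functions from ANY bump-separating
  class `𝒞` of real functions (smooth compactly supported functions on a manifold, Bruhat–Schwartz functions on
  an adelic group, …), proved via `Q = Re(conj P(x₀)·P) > 0` near `x₀`; corollaries
  `eq_zero_of_forall_integral_real_mul_conj_eq_zero` (real `C_c` test functions suffice) and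
  `eq_zero_of_forall_integral_conj_mul_eq_zero` (the other order of the factors);
* `eq_zero_of_unfolding` — the inference phrased over an abstract pairing `pair f` satisfying an unfolding
  identity `pair f = ∫ f · conj P dμ`;
* `continuous_toricCoeff` — a period-type coefficient `h ↦ ∫_T w(t) v(jT(t)·h) dν(t)` of a continuous `v` on a
  topological group `G` against a continuous compactly supported weight `w` on a space `T` mapping
  continuously to `G` is continuous (`continuousOn_integral_of_compact_support`), and
  `toricCoeff_eq_zero_of_forall_test` (`_haar`) — the two combined:
  `(∀ f ∈ C_c(G), ∫ f(h) conj(∫ w(t) v(jT t * h) dν) dμ = 0) → ∀ h, ∫ w(t) v(jT t * h) dν = 0`.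

The classical statement (du Bois-Reymond's lemma) is for `C_c^∞` test functions on an open subset of `ℝⁿ` and
a locally integrable `P`, concluding `P = 0` a.e.; the continuous version on a general locally compact space
with a measure positive on opens is what representation-theoretic unfolding arguments use [folklore].
Mathlib has the `ℝⁿ` / a.e. relatives (`ae_eq_zero_of_integral_contDiff_smul_eq_zero`, …); the tree has
several special cases on Euclidean spaces (`Literature/Analysis/FluidPDE/*`); this file is the general
locally-compact, complex-sesquilinear form.

## Provenance

Reproduced for the tree under the LEAN-IN-TREE rule (2026-08-18) from the pub-hodgecm cell's package file
`HodgeCM/PerL34/Vanishing.lean` (DAG-node prover #06 lineage, seat pv06 generation 0, gate run 20; 307 lines,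
namespace `HodgeCM.PerL34.Vanishing`), verbatim up to the namespace and the docstrings, with its Urysohn bumps
`exists_bump` / `exists_bump_subset` replaced by the tree's `BumpApprox.exists_bump_subset` (ported earlier from the
same source by seat pv15-g6); Mathlib + that tree file only, nothing cited as a hypothesis, nothing posited.
-/

set_option autoImplicit false

open MeasureTheory Set

noncomputable section

namespace Literature.MeasureTheory.Integral

namespace FundamentalLemma

/-! ### The fundamental lemma (complex, sesquilinear form) -/

section FundamentalLemma

variable {X : Type*} [TopologicalSpace X] [LocallyCompactSpace X] [T2Space X]
  [MeasurableSpace X] [BorelSpace X] (μ : Measure X) [IsFiniteMeasureOnCompacts μ] [μ.IsOpenPosMeasure]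

/-- **Fundamental lemma of the calculus of variations**, continuous sesquilinear complex form: on a locally
compact Hausdorff space with a measure that is finite on compact sets and charges every nonempty open set
(e.g. a Haar measure), a continuous `P : X → ℂ` with `∫ f · conj P dμ = 0` for every continuous compactly
supported `f` is zero (test against `f = φ · P`, `φ` an Urysohn bump at `x₀`: `∫ φ ‖P‖² dμ = 0`). [folklore] -/
theorem eq_zero_of_forall_integral_mul_conj_eq_zero {P : X → ℂ} (hP : Continuous P)
    (h : ∀ f : X → ℂ, Continuous f → HasCompactSupport f →
      ∫ x, f x * starRingEnd ℂ (P x) ∂μ = 0) :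
    P = 0 := by
  funext x₀
  rw [Pi.zero_apply]
  by_contra hne
  obtain ⟨φ, hφc, hφs, hφ0, hφ1, -⟩ := BumpApprox.exists_bump_subset x₀ isOpen_univ (mem_univ x₀)
  have hKφ : ∀ x ∉ tsupport φ, φ x = 0 := fun x hx => image_eq_zero_of_notMem_tsupport hx
  -- the test function `φ · P`
  set f : X → ℂ := fun x => (φ x : ℂ) * P x with hf
  have hfc : Continuous f := (Complex.continuous_ofReal.comp hφc).mul hP
  have hfs : HasCompactSupport f :=
    HasCompactSupport.intro hφs.isCompact fun x hx => by simp [hf, hKφ x hx]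
  have key := h f hfc hfs
  -- its pairing with `P` is the integral of the real function `φ ‖P‖²`
  set g : X → ℝ := fun x => φ x * ‖P x‖ ^ 2 with hg
  have hfg : (fun x => f x * starRingEnd ℂ (P x)) = fun x => ((g x : ℝ) : ℂ) := by
    funext x
    have e1 : f x * starRingEnd ℂ (P x) = (φ x : ℂ) * (P x * starRingEnd ℂ (P x)) := by
      simp only [hf]; ring
    rw [e1, Complex.mul_conj, Complex.normSq_eq_norm_sq, hg]
    push_cast
    ring
  rw [hfg, integral_complex_ofReal, Complex.ofReal_eq_zero] at key
  have hgc : Continuous g := hφc.mul (hP.norm.pow 2)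
  have hgs : HasCompactSupport g :=
    HasCompactSupport.intro hφs.isCompact fun x hx => by simp [hg, hKφ x hx]
  have hg0 : 0 ≤ g := fun x => mul_nonneg (hφ0 x) (sq_nonneg _)
  have hgx : g x₀ ≠ 0 := by
    intro h0
    have h1 : ‖P x₀‖ ^ 2 = 0 := by simpa [hg, hφ1] using h0
    exact hne (norm_eq_zero.mp ((pow_eq_zero_iff two_ne_zero).mp h1))
  exact (hgc.integral_pos_of_hasCompactSupport_nonneg_nonzero hgs hg0 hgx).ne' key

omit [LocallyCompactSpace X] in
/-- **Fundamental lemma, test functions from a bump-separating class** (e.g. `C_c^∞` on a manifold, or on an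
adelic group the functions smooth at the archimedean places and locally constant at the finite ones): any class
`𝒞` of real test functions containing, at every point and inside every open neighbourhood of it, a continuous
compactly supported nonnegative function not vanishing at the point will do, and local compactness of `X` is
then not needed.  If `∫ f · conj P dμ = 0` for every `f ∈ 𝒞` and `P` is continuous, then `P = 0`.  Proof: near
`x₀` the real function `Q = Re(conj P(x₀) · P)` exceeds `‖P x₀‖²/2 > 0`; test against a bump `f ∈ 𝒞` supported
there: `∫ f Q dμ = Re (P(x₀) · ∫ f conj P) = 0` with `f Q` continuous, compactly supported, `≥ 0`, `≠ 0` at `x₀`.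
[folklore] -/
theorem eq_zero_of_forall_bump_integral_mul_conj_eq_zero (𝒞 : (X → ℝ) → Prop)
    (hbump : ∀ (x₀ : X) (U : Set X), IsOpen U → x₀ ∈ U →
      ∃ f : X → ℝ, 𝒞 f ∧ Continuous f ∧ HasCompactSupport f ∧ (∀ x, 0 ≤ f x) ∧ f x₀ ≠ 0 ∧
        Function.support f ⊆ U)
    {P : X → ℂ} (hP : Continuous P)
    (h : ∀ f : X → ℝ, 𝒞 f → ∫ x, (f x : ℂ) * starRingEnd ℂ (P x) ∂μ = 0) :
    P = 0 := by
  funext x₀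
  rw [Pi.zero_apply]
  by_contra hne
  set c : ℂ := P x₀ with hc
  -- the real function `Q = Re(conj c · P)`, `> ‖c‖²/2` near `x₀`
  set Q : X → ℝ := fun x => c.re * (P x).re + c.im * (P x).im with hQ
  have hQc : Continuous Q :=
    (continuous_const.mul (Complex.continuous_re.comp hP)).add
      (continuous_const.mul (Complex.continuous_im.comp hP))
  have hQx₀ : Q x₀ = ‖c‖ ^ 2 := by
    show c.re * (P x₀).re + c.im * (P x₀).im = ‖c‖ ^ 2
    rw [← hc, ← Complex.normSq_eq_norm_sq, Complex.normSq_apply]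
  have hpos : 0 < ‖c‖ ^ 2 := by
    have : 0 < ‖c‖ := norm_pos_iff.mpr hne
    positivity
  set U : Set X := {x | ‖c‖ ^ 2 / 2 < Q x} with hU
  have hUo : IsOpen U := isOpen_lt continuous_const hQc
  have hx₀U : x₀ ∈ U := by
    show ‖c‖ ^ 2 / 2 < Q x₀
    rw [hQx₀]; linarith
  obtain ⟨f, hf𝒞, hfc, hfs, hf0, hfx₀, hsupp⟩ := hbump x₀ U hUo hx₀U
  have key := h f hf𝒞
  -- `g = f · Q`: continuous, compactly supported, `≥ 0`, `≠ 0` at `x₀`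
  set g : X → ℝ := fun x => f x * Q x with hg
  have hgc : Continuous g := hfc.mul hQc
  have hgs : HasCompactSupport g :=
    HasCompactSupport.intro hfs.isCompact fun x hx => by
      simp [hg, image_eq_zero_of_notMem_tsupport hx]
  have hg0 : 0 ≤ g := by
    intro x
    by_cases hx : x ∈ U
    · have hx' : ‖c‖ ^ 2 / 2 < Q x := hx
      exact mul_nonneg (hf0 x) (le_of_lt (lt_trans (half_pos hpos) hx'))
    · have hfx : f x = 0 := Function.notMem_support.mp fun hx' => hx (hsupp hx')
      simp [hg, hfx]
  have hgx₀ : g x₀ ≠ 0 := by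
    show f x₀ * Q x₀ ≠ 0
    rw [hQx₀]
    exact mul_ne_zero hfx₀ hpos.ne'
  -- `∫ g dμ = Re (c · ∫ f conj P dμ) = 0`
  have hint : Integrable (fun x => (f x : ℂ) * starRingEnd ℂ (P x)) μ := by
    refine ((Complex.continuous_ofReal.comp hfc).mul
      (Complex.continuous_conj.comp hP)).integrable_of_hasCompactSupport ?_
    exact HasCompactSupport.intro hfs.isCompact fun x hx => by
      simp [image_eq_zero_of_notMem_tsupport hx]
  have hre : ∫ x, g x ∂μ = (c * ∫ x, (f x : ℂ) * starRingEnd ℂ (P x) ∂μ).re := by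
    rw [← integral_const_mul, ← RCLike.re_to_complex, ← integral_re (hint.const_mul c)]
    congr 1
    funext x
    simp only [hg, hQ, RCLike.re_to_complex, Complex.mul_re, Complex.mul_im, Complex.ofReal_re,
      Complex.ofReal_im, Complex.conj_re, Complex.conj_im]
    ring
  rw [key, mul_zero, Complex.zero_re] at hre
  exact (hgc.integral_pos_of_hasCompactSupport_nonneg_nonzero hgs hg0 hgx₀).ne' hre

/-- Corollary: REAL-valued continuous compactly supported test functions suffice. [folklore] -/
theorem eq_zero_of_forall_integral_real_mul_conj_eq_zero {P : X → ℂ} (hP : Continuous P)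
    (h : ∀ f : X → ℝ, Continuous f → HasCompactSupport f →
      ∫ x, (f x : ℂ) * starRingEnd ℂ (P x) ∂μ = 0) :
    P = 0 := by
  refine eq_zero_of_forall_bump_integral_mul_conj_eq_zero μ
    (fun f => Continuous f ∧ HasCompactSupport f) ?_ hP (fun f hf => h f hf.1 hf.2)
  intro x₀ U hU hxU
  obtain ⟨φ, hφc, hφs, hφ0, hφ1, hsupp⟩ := BumpApprox.exists_bump_subset x₀ hU hxU
  exact ⟨φ, ⟨hφc, hφs⟩, hφc, hφs, hφ0, by rw [hφ1]; exact one_ne_zero, hsupp⟩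

/-- The same with the pairing written `∫ conj P · f` (either order of the factors). [folklore] -/
theorem eq_zero_of_forall_integral_conj_mul_eq_zero {P : X → ℂ} (hP : Continuous P)
    (h : ∀ f : X → ℂ, Continuous f → HasCompactSupport f →
      ∫ x, starRingEnd ℂ (P x) * f x ∂μ = 0) :
    P = 0 :=
  eq_zero_of_forall_integral_mul_conj_eq_zero μ hP fun f hf hfs => by
    simpa only [mul_comm] using h f hf hfs

/-- The inference over an abstract pairing (the shape in which it is used after an unfolding identity, e.g.
`pair f = ⟨E_f, v⟩` for a family of vectors `E_f` indexed by test functions): if `pair f` UNFOLDS as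
`∫ f · conj P dμ` for every test function `f`, `P` is continuous, and `pair f = 0` for all test `f`, then
`P ≡ 0`. [folklore] -/
theorem eq_zero_of_unfolding {P : X → ℂ} (hP : Continuous P) (pair : (X → ℂ) → ℂ)
    (hunf : ∀ f : X → ℂ, Continuous f → HasCompactSupport f →
      pair f = ∫ x, f x * starRingEnd ℂ (P x) ∂μ)
    (hv : ∀ f : X → ℂ, Continuous f → HasCompactSupport f → pair f = 0) :
    ∀ x, P x = 0 := by
  have hP0 := eq_zero_of_forall_integral_mul_conj_eq_zero μ hP fun f hf hfs => by
    rw [← hunf f hf hfs, hv f hf hfs]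
  intro x
  exact congrFun hP0 x

end FundamentalLemma

/-! ### Period-type coefficients `h ↦ ∫_T w(t) v(jT(t) h) dν(t)` -/

section ToricCoefficient

variable {G : Type*} [Group G] [TopologicalSpace G] [IsTopologicalGroup G]
  {T : Type*} [TopologicalSpace T] [MeasurableSpace T] [OpensMeasurableSpace T]

/-- Continuity of a period-type coefficient: for `v : G → ℂ` continuous, `jT : T → G` continuous and a
continuous compactly supported weight `w` on `T` (e.g. `w t = β(t) conj χ(t)` with `χ` a character and `β` a
compactly supported cut-off), the coefficient `h ↦ ∫ w(t) v(jT(t) h) dν` is continuous on `G` (uniformly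
compactly supported continuous kernel, `continuousOn_integral_of_compact_support`). [folklore] -/
theorem continuous_toricCoeff (ν : Measure T) [IsFiniteMeasureOnCompacts ν]
    (jT : T → G) (hjT : Continuous jT) (w : T → ℂ) (hw : Continuous w) (hws : HasCompactSupport w)
    (v : G → ℂ) (hv : Continuous v) :
    Continuous fun h : G => ∫ t, w t * v (jT t * h) ∂ν := by
  have hk : IsCompact (tsupport w) := hws
  have hF : ContinuousOn
      (Function.uncurry fun (h : G) (t : T) => w t * v (jT t * h)) (univ ×ˢ univ) := by
    apply Continuous.continuousOn
    change Continuous fun p : G × T => w p.2 * v (jT p.2 * p.1)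
    exact (hw.comp continuous_snd).mul (hv.comp ((hjT.comp continuous_snd).mul continuous_fst))
  have hzero : ∀ (p : G) (t : T), p ∈ (univ : Set G) → t ∉ tsupport w →
      (fun (h : G) (t : T) => w t * v (jT t * h)) p t = 0 := by
    intro p t _ ht
    simp only [image_eq_zero_of_notMem_tsupport ht, zero_mul]
  exact continuousOn_univ.mp (continuousOn_integral_of_compact_support (μ := ν) hk hF hzero)

variable [LocallyCompactSpace G] [T2Space G] [MeasurableSpace G] [BorelSpace G]

/-- The two combined: with `μ` on `G` finite on compacts and positive on opens (e.g. a Haar measure), `ν` on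
`T` finite on compacts, `w` a continuous compactly supported weight and `v` continuous, if
`∫_G f(h) conj(∫_T w(t) v(jT(t) h) dν) dμ = 0` for every `f ∈ C_c(G)`, then the coefficient
`h ↦ ∫_T w(t) v(jT(t) h) dν` vanishes IDENTICALLY. [folklore] -/
theorem toricCoeff_eq_zero_of_forall_test
    (μ : Measure G) [IsFiniteMeasureOnCompacts μ] [μ.IsOpenPosMeasure]
    (ν : Measure T) [IsFiniteMeasureOnCompacts ν]
    (jT : T → G) (hjT : Continuous jT) (w : T → ℂ) (hw : Continuous w) (hws : HasCompactSupport w)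
    (v : G → ℂ) (hv : Continuous v)
    (h : ∀ f : G → ℂ, Continuous f → HasCompactSupport f →
      ∫ x, f x * starRingEnd ℂ (∫ t, w t * v (jT t * x) ∂ν) ∂μ = 0) :
    ∀ x : G, ∫ t, w t * v (jT t * x) ∂ν = 0 := by
  have hP0 := eq_zero_of_forall_integral_mul_conj_eq_zero μ
    (continuous_toricCoeff ν jT hjT w hw hws v hv) h
  intro x
  exact congrFun hP0 x

/-- The same for a Haar measure `μ` (instances `IsHaarMeasure → IsFiniteMeasureOnCompacts`,
`IsHaarMeasure → IsOpenPosMeasure` found by instance resolution; stated for the record). [folklore] -/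
theorem toricCoeff_eq_zero_of_forall_test_haar
    (μ : Measure G) [μ.IsHaarMeasure] (ν : Measure T) [IsFiniteMeasureOnCompacts ν]
    (jT : T → G) (hjT : Continuous jT) (w : T → ℂ) (hw : Continuous w) (hws : HasCompactSupport w)
    (v : G → ℂ) (hv : Continuous v)
    (h : ∀ f : G → ℂ, Continuous f → HasCompactSupport f →
      ∫ x, f x * starRingEnd ℂ (∫ t, w t * v (jT t * x) ∂ν) ∂μ = 0) :
    ∀ x : G, ∫ t, w t * v (jT t * x) ∂ν = 0 :=
  toricCoeff_eq_zero_of_forall_test μ ν jT hjT w hw hws v hv h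

end ToricCoefficient

end FundamentalLemma

end Literature.MeasureTheory.Integral

end
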